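import Literature.NumberTheory.LFunctions.KusminLandauSharp
import HarnessLib

/-!
# Yang's explicit second-derivative test (Yang 2024, Lemma 2.1)

Topic `Literature/NumberTheory/LFunctions`. A. Yang, *Explicit bounds on `ζ(s)` in the critical
strip and a zero-free region*, J. Math. Anal. Appl. 534 (2024) = arXiv:2301.03165, Lemma 2.1
(second-derivative test): "Suppose `f(x)` is real-valued and twice continuously differentiable on
`[a, a + N]` for some integers `a, N`, with `f''(x)` monotonic and satisfying
`λ₂ ≤ |f''(x)| ≤ hλ₂` (`x ∈ [a, a + N]`) for some `λ₂ > 0` and `h > 1`. Then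
`S_f(a, N) ≤ (4/√π) N h λ₂^{1/2} + N h λ₂ + (4/√π) λ₂^{-1/2}`", where
`S_f(a, N) = |∑_{a < n ≤ a+N} e(f(n))|`. (The monotonicity of `f''` is not used in the printed
proof and is not assumed here; `h ≥ 1` suffices.) This is the base (`B(0,1)`) of the explicit
`k`-th derivative tests of Yang (Lemmas 2.4–2.5) and of Patel–Yang's Lemma 1.4, the constants of
which enter the explicit sub-Weyl bound for `ζ(1/2 + it)`.

Everything here is PROVED, following the printed proof: the integers `a < n ≤ a + N` are divided
according to the value of `f'(n)` into windows of `f'`-width `2Δ` around the integers (at most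
`2Δ/λ₂ + 1` points each), stretches on which `‖f'‖ ≥ Δ` (the sharp Kusmin–Landau bound `2/(πΔ)`,
`Literature.NumberTheory.LFunctions.VdC.kusminLandau_deriv`), and the two boundary pieces, treated
by the three cases of the printed proof with the generalised Kusmin–Landau bound
`(λ₁⁻¹ + μ₁⁻¹)/π`; then `Δ = (λ₂/π)^{1/2}` and the inequality `J(ε) ≤ 2/(πΔ)` of the source.
Hypotheses are in the tree's increment form `Literature.NumberTheory.LFunctions.VdC.SecondDerivHyp`
(`λ(y₂ - y₁) ≤ f'(y₂) - f'(y₁) ≤ hλ(y₂ - y₁)`), derived from `λ ≤ ±f'' ≤ hλ` in the final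
statements.

## Main results

* `Literature.NumberTheory.LFunctions.VdC.secondDerivTest_yang_core` — the bound under
  `SecondDerivHyp f f' a b λ h` (`f'` increasing).
* `Literature.NumberTheory.LFunctions.VdC.secondDerivTest_yang` — **Yang's Lemma 2.1**: `f, f'`
  differentiable on `[a, b]` (`a ≤ b` integers), `λ ≤ f'' ≤ hλ` or `λ ≤ -f'' ≤ hλ` there
  (`λ > 0`, `h ≥ 1`); then
  `‖∑_{a<n≤b} e(f(n))‖ ≤ (4/√π)(b - a) h λ^{1/2} + (b - a) h λ + (4/√π) λ^{-1/2}`.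

## References

* A. Yang, *Explicit bounds on `ζ(s)` in the critical strip and a zero-free region*, J. Math.
  Anal. Appl. 534 (2024), no. 2, 128124 = arXiv:2301.03165v3, Lemma 2.1 and its proof.
  [cite: Yang2024, Lemma 2.1]
* G. A. Hiary, D. Patel, A. Yang, *An improved explicit estimate for `ζ(1/2 + it)`*, J. Number
  Theory 256 (2024) 195–217, Lemma 2.3 (Kusmin–Landau) and Lemma 2.5 (the model of the proof).
  [cite: HiaryPatelYang2024, Lemma 2.5]
-/

noncomputable section

open Finset Real

namespace Literature.NumberTheory.LFunctions
namespace VdC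

namespace SecondDerivHyp

variable {f f' : ℝ → ℝ} {a b : ℤ} {lam h : ℝ}

/-- Members of `(a, b]` lie in `[a, b]` (as reals). [folklore] -/
theorem memI {n : ℤ} (hn : n ∈ Finset.Ioc a b) : ((n : ℤ) : ℝ) ∈ Set.Icc (a : ℝ) b := by
  rw [Finset.mem_Ioc] at hn
  exact ⟨by exact_mod_cast hn.1.le, by exact_mod_cast hn.2⟩

/-- The lower increment bound between two integer points `n₁ ≤ n₂` of `(a, b]`. [folklore] -/
theorem gap (H : SecondDerivHyp f f' a b lam h) {n₁ n₂ : ℤ} (h₁ : n₁ ∈ Finset.Ioc a b)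
    (h₂ : n₂ ∈ Finset.Ioc a b) (h12 : n₁ ≤ n₂) :
    lam * ((n₂ : ℝ) - n₁) ≤ f' n₂ - f' n₁ :=
  (H.incr _ (memI h₁) _ (memI h₂) (by exact_mod_cast h12)).1

/-- Values at integer points of `(a, b]` lie between `f'(a)` and `f'(b)`. [folklore] -/
theorem value_between (H : SecondDerivHyp f f' a b lam h) (hlam : 0 < lam) {n : ℤ}
    (hn : n ∈ Finset.Ioc a b) : f' a ≤ f' n ∧ f' n ≤ f' b := by
  have hnI := memI hn
  have hab : (a : ℝ) ≤ b := hnI.1.trans hnI.2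
  exact ⟨H.mono hlam ⟨le_rfl, hab⟩ hnI hnI.1, H.mono hlam hnI ⟨hab, le_rfl⟩ hnI.2⟩

/-- **Counting lemma.** A set of integer points of `(a, b]` on which the values of `f'` vary by
less than... at most `ℓ` has at most `ℓ/λ + 1` elements (`f'` increases at rate `≥ λ`). [folklore] -/
theorem card_le_of_values (H : SecondDerivHyp f f' a b lam h) (hlam : 0 < lam) {S : Finset ℤ}
    (hS : S ⊆ Finset.Ioc a b) {ℓ : ℝ} (hℓ : 0 ≤ ℓ)
    (hval : ∀ n₁ ∈ S, ∀ n₂ ∈ S, f' n₂ - f' n₁ ≤ ℓ) : (S.card : ℝ) ≤ ℓ / lam + 1 := by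
  refine card_le_of_diam (by positivity) fun n₁ hn₁ n₂ hn₂ h12 => ?_
  have h1 := H.gap (hS hn₁) (hS hn₂) h12
  have h2 := hval n₁ hn₁ n₂ hn₂
  rw [le_div_iff₀ hlam]
  linarith

/-- **Kusmin–Landau on a piece.** If `S ⊆ (a, b]` is closed under betweenness and the values of
`f'` on `S` lie in `[ν + λ', ν + 1 - μ']` (`λ', μ' > 0`), then `‖∑_{n ∈ S} e(f(n))‖ ≤ (1/λ' + 1/μ')/π`
(sharp generalised Kusmin–Landau, Hiary–Patel–Yang Lemma 2.3). [cite: HiaryPatelYang2024, Lemma 2.3] -/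
theorem kl_piece (H : SecondDerivHyp f f' a b lam h) (hlam : 0 < lam) {S : Finset ℤ}
    (hS : S ⊆ Finset.Ioc a b)
    (hbetween : ∀ n₁ ∈ S, ∀ n₂ ∈ S, ∀ n, n₁ ≤ n → n ≤ n₂ → n ∈ S)
    {ν : ℤ} {lam' mu' : ℝ} (hlam' : 0 < lam') (hmu' : 0 < mu')
    (hval : ∀ n ∈ S, (ν : ℝ) + lam' ≤ f' n ∧ f' n ≤ ν + 1 - mu') :
    ‖∑ n ∈ S, e (f n)‖ ≤ (1 / lam' + 1 / mu') / π := by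
  rcases S.eq_empty_or_nonempty with rfl | hne
  · rw [sum_empty, norm_zero]; exact div_nonneg (by positivity) Real.pi_pos.le
  have hSI : S = Finset.Icc (S.min' hne) (S.max' hne) := eq_Icc_of_between hne hbetween
  set m := S.min' hne with hm
  set M := S.max' hne with hM
  have hmS : m ∈ S := S.min'_mem hne
  have hMS : M ∈ S := S.max'_mem hne
  have hmI := memI (hS hmS)
  have hMI := memI (hS hMS)
  have hsub : Set.Icc ((m : ℤ) : ℝ) M ⊆ Set.Icc (a : ℝ) b := Set.Icc_subset_Icc hmI.1 hMI.2
  have hmono : MonotoneOn f' (Set.Icc ((m : ℤ) : ℝ) M) := fun y₁ hy₁ y₂ hy₂ h12 =>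
    H.mono hlam (hsub hy₁) (hsub hy₂) h12
  have h := kusminLandau_deriv (f := f) (f' := f') (a := ((m : ℤ) : ℝ)) (b := ((M : ℤ) : ℝ))
    (ν := ν) hlam' hmu' (fun y hy => H.hasDeriv y (hsub hy)) (Or.inl hmono) ?_
  · rw [Int.ceil_intCast, Int.floor_intCast] at h
    rwa [hSI]
  · intro y hy
    have h1 : f' m ≤ f' y := H.mono hlam hmI (hsub hy) hy.1
    have h2 : f' y ≤ f' M := H.mono hlam (hsub hy) hMI hy.2
    exact ⟨(hval m hmS).1.trans h1, h2.trans (hval M hMS).2⟩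

/-- A subset of `(a, b]` which contains, with two points, every point of `(a, b]` whose `f'`-value
lies between theirs, is closed under betweenness (since `f'` is monotone). [folklore] -/
theorem between_of_valueClosed (H : SecondDerivHyp f f' a b lam h) (hlam : 0 < lam) {S : Finset ℤ}
    (hp : ∀ n₁ ∈ S, ∀ n₂ ∈ S, ∀ n ∈ Finset.Ioc a b, f' n₁ ≤ f' n → f' n ≤ f' n₂ → n ∈ S)
    (hS : S ⊆ Finset.Ioc a b) :
    ∀ n₁ ∈ S, ∀ n₂ ∈ S, ∀ n, n₁ ≤ n → n ≤ n₂ → n ∈ S := by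
  intro n₁ hn₁ n₂ hn₂ n h1 h2
  have hT₁ := hS hn₁
  have hT₂ := hS hn₂
  have hnI : n ∈ Finset.Ioc a b := by
    rw [Finset.mem_Ioc] at hT₁ hT₂ ⊢
    exact ⟨lt_of_lt_of_le hT₁.1 h1, h2.trans hT₂.2⟩
  refine hp n₁ hn₁ n₂ hn₂ n hnI ?_ ?_
  · exact H.mono hlam (memI hT₁) (memI hnI) (by exact_mod_cast h1)
  · exact H.mono hlam (memI hnI) (memI hT₂) (by exact_mod_cast h2)

/-- Kusmin–Landau on a value-closed piece `S ⊆ (a, b]` with values in `[ν + λ', ν + 1 - μ']`.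
[cite: HiaryPatelYang2024, Lemma 2.3] -/
theorem kl_vpiece (H : SecondDerivHyp f f' a b lam h) (hlam : 0 < lam) {S : Finset ℤ}
    (hS : S ⊆ Finset.Ioc a b)
    (hp : ∀ n₁ ∈ S, ∀ n₂ ∈ S, ∀ n ∈ Finset.Ioc a b, f' n₁ ≤ f' n → f' n ≤ f' n₂ → n ∈ S)
    {ν : ℤ} {lam' mu' : ℝ} (hlam' : 0 < lam') (hmu' : 0 < mu')
    (hval : ∀ n ∈ S, (ν : ℝ) + lam' ≤ f' n ∧ f' n ≤ ν + 1 - mu') :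
    ‖∑ n ∈ S, e (f n)‖ ≤ (1 / lam' + 1 / mu') / π :=
  H.kl_piece hlam hS (H.between_of_valueClosed hlam hp hS) hlam' hmu' hval

end SecondDerivHyp

end VdC
end Literature.NumberTheory.LFunctions

namespace Literature.NumberTheory.LFunctions
namespace VdC

/-! ### The three elementary inequalities `J(ε) ≤ 2/(πΔ)` of the printed proof

With `Φ(ε) := 3/(πΔ) - (4/(πΔ) + 1)(ε - 1/2)` (written out in full below; `Φ = 1/(πΔ) + H_Δ + 2/(πΔ) - J`
in the notation of the source), the bound of each boundary piece is `≤ Φ(ε)` in each of the three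
cases, provided `0 < Δ ≤ 1/4` and `λ = πΔ²`. -/

/-- Case 1 (`0 ≤ ε < Δ`): `(Δ - ε)/λ + 1 + 2/(πΔ) ≤ Φ(ε)`. [cite: Yang2024, Lemma 2.1 (proof, Case 1)] -/
theorem J_case1 {Δ lam ε : ℝ} (hΔ : 0 < Δ) (hΔ4 : Δ ≤ 1 / 4) (hlamΔ : lam = π * Δ ^ 2)
    (hε0 : 0 ≤ ε) (hε : ε < Δ) : (Δ - ε) / lam + 1 + 2 / (π * Δ) ≤ (3 / (π * Δ) - (4 / (π * Δ) + 1) * (ε - 1 / 2)) := by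
  have hπ := Real.pi_pos
  have hp : 0 < π * Δ := by positivity
  have hp1 : π * Δ ≤ 1 := by nlinarith [Real.pi_lt_four]
  have hlam0 : 0 < lam := by rw [hlamΔ]; positivity
  have h1 : (Δ - ε) / lam ≤ 1 / (π * Δ) := by
    rw [div_le_div_iff₀ hlam0 hp, hlamΔ]; nlinarith
  have h2 : (4 : ℝ) ≤ 4 / (π * Δ) + 1 := by
    have : (4 : ℝ) ≤ 4 / (π * Δ) := by rw [le_div_iff₀ hp]; nlinarith
    linarith
  have h3 : 1 / 4 ≤ 1 / 2 - ε := by linarith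
  have h4 : (1 : ℝ) ≤ (4 / (π * Δ) + 1) * (1 / 2 - ε) := by nlinarith
  have e1 : 3 / (π * Δ) = 1 / (π * Δ) + 2 / (π * Δ) := by ring
  nlinarith

/-- Case 2 (`Δ ≤ ε ≤ 1 - Δ`): `(1/ε + 1/Δ)/π ≤ Φ(ε)`. [cite: Yang2024, Lemma 2.1 (proof, Case 2)] -/
theorem J_case2 {Δ ε : ℝ} (hΔ : 0 < Δ) (hΔ4 : Δ ≤ 1 / 4) (hε1 : Δ ≤ ε) (hε2 : ε ≤ 1 - Δ) :
    (1 / ε + 1 / Δ) / π ≤ (3 / (π * Δ) - (4 / (π * Δ) + 1) * (ε - 1 / 2)) := by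
  have hπ := Real.pi_pos
  have hε0 : 0 < ε := lt_of_lt_of_le hΔ hε1
  have hp : 0 < π * Δ := by positivity
  have e1 : (1 / ε + 1 / Δ) / π = 1 / (π * ε) + 1 / (π * Δ) := by
    field_simp
  rw [e1]
  -- it suffices: 1/(πε) + (4/(πΔ)+1)(ε - 1/2) ≤ 2/(πΔ)
  suffices h : 1 / (π * ε) + (4 / (π * Δ) + 1) * (ε - 1 / 2) ≤ 2 / (π * Δ) by
    have e2 : 3 / (π * Δ) = 1 / (π * Δ) + 2 / (π * Δ) := by ring
    linarith
  rcases le_or_gt ε (1 / 2) with hhalf | hhalf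
  · have h1 : 1 / (π * ε) ≤ 1 / (π * Δ) :=
      one_div_le_one_div_of_le hp (mul_le_mul_of_nonneg_left hε1 hπ.le)
    have h2 : (4 / (π * Δ) + 1) * (ε - 1 / 2) ≤ 0 :=
      mul_nonpos_of_nonneg_of_nonpos (by positivity) (by linarith)
    have h3 : 0 ≤ 1 / (π * Δ) := by positivity
    have e2 : 2 / (π * Δ) = 2 * (1 / (π * Δ)) := by ring
    linarith
  · have h1 : 1 / (π * ε) ≤ 2 / π := by
      rw [div_le_div_iff₀ (by positivity) hπ]; nlinarith
    have h2 : (4 / (π * Δ) + 1) * (ε - 1 / 2) ≤ (4 / (π * Δ) + 1) * (1 / 2 - Δ) :=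
      mul_le_mul_of_nonneg_left (by linarith) (by positivity)
    have e3 : (4 / (π * Δ) + 1) * (1 / 2 - Δ) = 2 / (π * Δ) - 4 / π + (1 / 2 - Δ) := by
      field_simp; ring
    have h4 : (1 / 2 : ℝ) ≤ 2 / π := by
      rw [le_div_iff₀ hπ]; linarith [Real.pi_lt_four]
    have e4 : 4 / π = 2 * (2 / π) := by ring
    linarith

/-- Case 3 (`1 - Δ < ε ≤ 1`): `0 ≤ Φ(ε)`. [cite: Yang2024, Lemma 2.1 (proof, Case 3)] -/
theorem J_case3 {Δ ε : ℝ} (hΔ : 0 < Δ) (hΔ4 : Δ ≤ 1 / 4) (hε : ε ≤ 1) : 0 ≤ (3 / (π * Δ) - (4 / (π * Δ) + 1) * (ε - 1 / 2)) := by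
  have hπ := Real.pi_pos
  have hp : 0 < π * Δ := by positivity
  have hp1 : π * Δ ≤ 1 := by nlinarith [Real.pi_lt_four]
  have h1 : (4 / (π * Δ) + 1) * (ε - 1 / 2) ≤ (4 / (π * Δ) + 1) * (1 / 2) :=
    mul_le_mul_of_nonneg_left (by linarith) (by positivity)
  have h2 : (1 : ℝ) ≤ 1 / (π * Δ) := by rw [le_div_iff₀ hp]; linarith
  have e : (4 / (π * Δ) + 1) * (1 / 2) = 2 / (π * Δ) + 1 / 2 := by ring
  have e2 : 3 / (π * Δ) = 2 / (π * Δ) + 1 / (π * Δ) := by ring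
  linarith

namespace SecondDerivHyp

variable {f f' : ℝ → ℝ} {a b : ℤ} {lam h : ℝ}

/-! ### The initial piece `{n : f'(n) ≤ C₀ + 1 - Δ}` -/

/-- **The initial boundary piece** (`C₀ = ⌊f'(a)⌋`, `ε₁ = {f'(a)}`): in each of the three cases
of the printed proof, `‖∑_{a<n≤b, f'(n) ≤ C₀+1-Δ} e(f(n))‖ ≤ Φ(ε₁)`.
[cite: Yang2024, Lemma 2.1 (proof)] -/
theorem initial_piece (H : SecondDerivHyp f f' a b lam h) (hlam : 0 < lam) {Δ : ℝ} (hΔ : 0 < Δ)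
    (hΔ4 : Δ ≤ 1 / 4) (hlamΔ : lam = π * Δ ^ 2) :
    ‖∑ n ∈ (Finset.Ioc a b).filter (fun n : ℤ => f' n ≤ ⌊f' a⌋ + 1 - Δ), e (f n)‖
      ≤ (3 / (π * Δ) - (4 / (π * Δ) + 1) * (Int.fract (f' a) - 1 / 2)) := by
  have hπ := Real.pi_pos
  set C₀ : ℤ := ⌊f' a⌋ with hC₀
  set ε₁ : ℝ := Int.fract (f' a) with hε₁
  have hfa : f' a = C₀ + ε₁ := by rw [hε₁, hC₀, Int.fract]; ring
  have hε₁0 : 0 ≤ ε₁ := Int.fract_nonneg _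
  have hε₁1 : ε₁ < 1 := Int.fract_lt_one _
  have hlow : ∀ n ∈ Finset.Ioc a b, (C₀ : ℝ) + ε₁ ≤ f' n := fun n hn =>
    hfa ▸ (H.value_between hlam hn).1
  rcases lt_or_ge (1 - Δ) ε₁ with h3 | h12
  · -- Case 3: the piece is empty
    have hempty : (Finset.Ioc a b).filter (fun n : ℤ => f' n ≤ ⌊f' a⌋ + 1 - Δ) = ∅ := by
      rw [Finset.filter_eq_empty_iff]
      intro n hn hle
      have := hlow n hn
      linarith
    rw [hempty, sum_empty, norm_zero]
    exact J_case3 hΔ hΔ4 hε₁1.le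
  rcases lt_or_ge ε₁ Δ with h1 | h2
  · -- Case 1: split the piece `I` at the value `C₀ + Δ`
    set I := (Finset.Ioc a b).filter (fun n : ℤ => f' n ≤ ⌊f' a⌋ + 1 - Δ) with hI
    have hmemI : ∀ n, n ∈ I ↔ n ∈ Finset.Ioc a b ∧ f' n ≤ C₀ + 1 - Δ := fun n => by
      rw [hI, Finset.mem_filter]
    have hIT : I ⊆ Finset.Ioc a b := Finset.filter_subset _ _
    rw [← Finset.sum_filter_add_sum_filter_not I (fun n : ℤ => f' n < C₀ + Δ)]
    have hA : (((I.filter fun n : ℤ => f' n < C₀ + Δ)).card : ℝ) ≤ (Δ - ε₁) / lam + 1 := by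
      refine H.card_le_of_values hlam ((Finset.filter_subset _ _).trans hIT) (ℓ := Δ - ε₁)
        (by linarith) fun n₁ hn₁ n₂ hn₂ => ?_
      rw [Finset.mem_filter, hmemI] at hn₁ hn₂
      have := hlow n₁ hn₁.1.1
      linarith [hn₂.2]
    have hB : ‖∑ n ∈ I.filter (fun n : ℤ => ¬ f' n < C₀ + Δ), e (f n)‖ ≤ (1 / Δ + 1 / Δ) / π := by
      refine H.kl_vpiece hlam ((Finset.filter_subset _ _).trans hIT) ?_ hΔ hΔ (ν := C₀) ?_
      · intro n₁ hn₁ n₂ hn₂ n hn h1n hn2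
        rw [Finset.mem_filter, hmemI] at hn₁ hn₂ ⊢
        exact ⟨⟨hn, hn2.trans hn₂.1.2⟩, fun hlt => hn₁.2 (lt_of_le_of_lt h1n hlt)⟩
      · intro n hn
        rw [Finset.mem_filter, hmemI] at hn
        exact ⟨by linarith [not_lt.1 hn.2], by linarith [hn.1.2]⟩
    have e2 : (1 / Δ + 1 / Δ) / π = 2 / (π * Δ) := by field_simp; ring
    calc _ ≤ (Δ - ε₁) / lam + 1 + (1 / Δ + 1 / Δ) / π :=
          (norm_add_le _ _).trans (add_le_add ((norm_sum_e_le_card _ (fun n => f n)).trans hA) hB)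
      _ = (Δ - ε₁) / lam + 1 + 2 / (π * Δ) := by rw [e2]
      _ ≤ (3 / (π * Δ) - (4 / (π * Δ) + 1) * (ε₁ - 1 / 2)) := J_case1 hΔ hΔ4 hlamΔ hε₁0 h1
  · -- Case 2: Kusmin–Landau with `(ε₁, Δ)` on the whole piece
    have hε₁pos : 0 < ε₁ := lt_of_lt_of_le hΔ h2
    have hB : ‖∑ n ∈ (Finset.Ioc a b).filter (fun n : ℤ => f' n ≤ ⌊f' a⌋ + 1 - Δ), e (f n)‖
        ≤ (1 / ε₁ + 1 / Δ) / π := by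
      refine H.kl_vpiece hlam (Finset.filter_subset _ _) ?_ hε₁pos hΔ (ν := C₀) ?_
      · intro n₁ _ n₂ hn₂ n hn _ hn2
        rw [Finset.mem_filter] at hn₂ ⊢
        exact ⟨hn, hn2.trans hn₂.2⟩
      · intro n hn
        rw [Finset.mem_filter] at hn
        have h1 := hlow n hn.1
        have h2' : f' n ≤ C₀ + 1 - Δ := hn.2
        exact ⟨h1, by linarith⟩
    exact hB.trans (J_case2 hΔ hΔ4 h2 h12)

/-! ### The final piece `{n : f'(n) ≥ C_k + Δ}` -/

/-- **The final boundary piece** (`C_k = ⌊f'(b)⌋`, `ε₂ = {f'(b)}`, `ε' = 1 - ε₂`):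
`‖∑_{a<n≤b, f'(n) ≥ C_k + Δ} e(f(n))‖ ≤ Φ(1 - ε₂)`. [cite: Yang2024, Lemma 2.1 (proof)] -/
theorem final_piece (H : SecondDerivHyp f f' a b lam h) (hlam : 0 < lam) {Δ : ℝ} (hΔ : 0 < Δ)
    (hΔ4 : Δ ≤ 1 / 4) (hlamΔ : lam = π * Δ ^ 2) :
    ‖∑ n ∈ (Finset.Ioc a b).filter (fun n : ℤ => (⌊f' b⌋ : ℝ) + Δ ≤ f' n), e (f n)‖
      ≤ (3 / (π * Δ) - (4 / (π * Δ) + 1) * (1 - Int.fract (f' b) - 1 / 2)) := by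
  have hπ := Real.pi_pos
  set Ck : ℤ := ⌊f' b⌋ with hCk
  set ε₂ : ℝ := Int.fract (f' b) with hε₂
  have hfb : f' b = Ck + ε₂ := by rw [hε₂, hCk, Int.fract]; ring
  have hε₂0 : 0 ≤ ε₂ := Int.fract_nonneg _
  have hε₂1 : ε₂ < 1 := Int.fract_lt_one _
  have hup : ∀ n ∈ Finset.Ioc a b, f' n ≤ (Ck : ℝ) + ε₂ := fun n hn =>
    hfb ▸ (H.value_between hlam hn).2
  rcases lt_or_ge ε₂ Δ with h3 | h12
  · -- Case 3': empty
    have hempty : (Finset.Ioc a b).filter (fun n : ℤ => (⌊f' b⌋ : ℝ) + Δ ≤ f' n) = ∅ := by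
      rw [Finset.filter_eq_empty_iff]
      intro n hn hle
      have := hup n hn
      rw [← hCk] at hle
      linarith
    rw [hempty, sum_empty, norm_zero]
    exact J_case3 hΔ hΔ4 (by linarith)
  rcases lt_or_ge (1 - Δ) ε₂ with h1 | h2
  · -- Case 1': split the piece `F` at the value `Ck + 1 - Δ`
    set F := (Finset.Ioc a b).filter (fun n : ℤ => (⌊f' b⌋ : ℝ) + Δ ≤ f' n) with hF
    have hmemF : ∀ n, n ∈ F ↔ n ∈ Finset.Ioc a b ∧ (Ck : ℝ) + Δ ≤ f' n := fun n => by
      rw [hF, Finset.mem_filter]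
    have hFT : F ⊆ Finset.Ioc a b := Finset.filter_subset _ _
    rw [← Finset.sum_filter_add_sum_filter_not F (fun n : ℤ => (Ck : ℝ) + 1 - Δ < f' n)]
    have hA : (((F.filter fun n : ℤ => (Ck : ℝ) + 1 - Δ < f' n)).card : ℝ) ≤ (Δ - (1 - ε₂)) / lam + 1 := by
      refine H.card_le_of_values hlam ((Finset.filter_subset _ _).trans hFT) (ℓ := Δ - (1 - ε₂))
        (by linarith) fun n₁ hn₁ n₂ hn₂ => ?_
      rw [Finset.mem_filter, hmemF] at hn₁ hn₂
      have := hup n₂ hn₂.1.1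
      linarith [hn₁.2]
    have hB : ‖∑ n ∈ F.filter (fun n : ℤ => ¬ (Ck : ℝ) + 1 - Δ < f' n), e (f n)‖
        ≤ (1 / Δ + 1 / Δ) / π := by
      refine H.kl_vpiece hlam ((Finset.filter_subset _ _).trans hFT) ?_ hΔ hΔ (ν := Ck) ?_
      · intro n₁ hn₁ n₂ hn₂ n hn h1n hn2
        rw [Finset.mem_filter, hmemF] at hn₁ hn₂ ⊢
        exact ⟨⟨hn, hn₁.1.2.trans h1n⟩, fun hlt => hn₂.2 (lt_of_lt_of_le hlt hn2)⟩
      · intro n hn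
        rw [Finset.mem_filter, hmemF] at hn
        exact ⟨by linarith [hn.1.2], by linarith [not_lt.1 hn.2]⟩
    have e2 : (1 / Δ + 1 / Δ) / π = 2 / (π * Δ) := by field_simp; ring
    calc _ ≤ (Δ - (1 - ε₂)) / lam + 1 + (1 / Δ + 1 / Δ) / π :=
          (norm_add_le _ _).trans (add_le_add ((norm_sum_e_le_card _ (fun n => f n)).trans hA) hB)
      _ = (Δ - (1 - ε₂)) / lam + 1 + 2 / (π * Δ) := by rw [e2]
      _ ≤ (3 / (π * Δ) - (4 / (π * Δ) + 1) * (1 - ε₂ - 1 / 2)) := J_case1 hΔ hΔ4 hlamΔ (by linarith) (by linarith)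
  · -- Case 2': Kusmin–Landau with `(Δ, 1 - ε₂)` on the whole piece
    have hε'pos : 0 < 1 - ε₂ := by linarith
    have hB : ‖∑ n ∈ (Finset.Ioc a b).filter (fun n : ℤ => (⌊f' b⌋ : ℝ) + Δ ≤ f' n), e (f n)‖
        ≤ (1 / Δ + 1 / (1 - ε₂)) / π := by
      refine H.kl_vpiece hlam (Finset.filter_subset _ _) ?_ hΔ hε'pos (ν := Ck) ?_
      · intro n₁ hn₁ n₂ _ n hn h1n _
        rw [Finset.mem_filter] at hn₁ ⊢
        exact ⟨hn, hn₁.2.trans h1n⟩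
      · intro n hn
        rw [Finset.mem_filter] at hn
        have h1 := hup n hn.1
        have h2' : (Ck : ℝ) + Δ ≤ f' n := hn.2
        exact ⟨h2', by linarith⟩
    have e : (1 / Δ + 1 / (1 - ε₂)) / π = (1 / (1 - ε₂) + 1 / Δ) / π := by ring
    rw [e] at hB
    exact hB.trans (J_case2 hΔ hΔ4 (by linarith) (by linarith))


/-! ### The windows `|f'(n) - C_j| < Δ`, `j = 1, …, k` -/

/-- **The windows.** The integer points of `(a, b]` whose `f'`-value is within `Δ` of one of the
integers `C₀ + 1, …, C_k` (`C₀ = ⌊f'(a)⌋`, `C_k = ⌊f'(b)⌋`) number at most `k(2Δ/λ + 1)`: each window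
has `f'`-width `< 2Δ`. (Membership: `{f'(n)} < Δ` and `⌊f'(n)⌋ > C₀`, or `{f'(n)} > 1 - Δ` and
`⌊f'(n)⌋ < C_k`.) [cite: Yang2024, Lemma 2.1 (proof, eq. for `y_j - x_j`)] -/
theorem windows_card (H : SecondDerivHyp f f' a b lam h) (hlam : 0 < lam) (hab : a ≤ b) {Δ : ℝ}
    (hΔ : 0 < Δ) (hΔ4 : Δ ≤ 1 / 4) :
    ((((Finset.Ioc a b).filter fun n : ℤ =>
        (Int.fract (f' n) < Δ ∧ ⌊f' a⌋ < ⌊f' n⌋) ∨ (1 - Δ < Int.fract (f' n) ∧ ⌊f' n⌋ < ⌊f' b⌋))).card : ℝ)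
      ≤ ((⌊f' b⌋ : ℝ) - ⌊f' a⌋) * (2 * Δ / lam + 1) := by
  set C₀ : ℤ := ⌊f' a⌋ with hC₀
  set Ck : ℤ := ⌊f' b⌋ with hCk
  set W := (Finset.Ioc a b).filter fun n : ℤ =>
        (Int.fract (f' n) < Δ ∧ C₀ < ⌊f' n⌋) ∨ (1 - Δ < Int.fract (f' n) ∧ ⌊f' n⌋ < Ck) with hW
  have hmemW : ∀ n, n ∈ W ↔ n ∈ Finset.Ioc a b ∧
      ((Int.fract (f' n) < Δ ∧ C₀ < ⌊f' n⌋) ∨ (1 - Δ < Int.fract (f' n) ∧ ⌊f' n⌋ < Ck)) := fun n => by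
    rw [hW, Finset.mem_filter]
  have hab' : (a : ℝ) ≤ b := by exact_mod_cast hab
  have hCC : C₀ ≤ Ck := Int.floor_mono (H.mono hlam ⟨le_rfl, hab'⟩ ⟨hab', le_rfl⟩ hab')
  -- the window index
  set w : ℤ → ℤ := fun n => if Int.fract (f' n) < Δ then ⌊f' n⌋ else ⌊f' n⌋ + 1 with hw
  set t : Finset ℤ := Finset.Icc (C₀ + 1) Ck with ht
  have hmaps : (W : Set ℤ).MapsTo w t := by
    intro n hn
    rw [Finset.mem_coe, hmemW] at hn
    rw [Finset.mem_coe, ht, Finset.mem_Icc, hw]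
    have hfl : C₀ ≤ ⌊f' n⌋ ∧ ⌊f' n⌋ ≤ Ck := by
      have := H.value_between hlam hn.1
      exact ⟨Int.floor_mono this.1, Int.floor_mono this.2⟩
    rcases hn.2 with ⟨h1, h2⟩ | ⟨h1, h2⟩
    · simp only [h1, if_true]; omega
    · have : ¬ Int.fract (f' n) < Δ := by linarith
      simp only [this, if_false]; omega
  have hcardt : (t.card : ℝ) = (Ck : ℝ) - C₀ := by
    rw [ht, Int.card_Icc]
    have h0 : (0 : ℤ) ≤ Ck + 1 - (C₀ + 1) := by omega
    have : (((Ck + 1 - (C₀ + 1)).toNat : ℕ) : ℤ) = Ck - C₀ := by rw [Int.toNat_of_nonneg h0]; ring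
    exact_mod_cast this
  -- each window has `f'`-width `< 2Δ`
  have hfib : ∀ c ∈ t, (((W.filter fun n : ℤ => w n = c)).card : ℝ) ≤ 2 * Δ / lam + 1 := by
    intro c _
    have hval : ∀ n ∈ W.filter (fun n : ℤ => w n = c), (c : ℝ) - Δ < f' n ∧ f' n < c + Δ := by
      intro n hn
      rw [Finset.mem_filter, hmemW, hw] at hn
      obtain ⟨⟨_, hcl⟩, hwn⟩ := hn
      have hff := Int.floor_add_fract (f' n)
      have hf0 := Int.fract_nonneg (f' n)
      have hf1 := Int.fract_lt_one (f' n)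
      by_cases hlt : Int.fract (f' n) < Δ
      · simp only [hlt, if_true] at hwn
        have hc : (⌊f' n⌋ : ℝ) = c := by exact_mod_cast hwn
        constructor <;> linarith
      · simp only [hlt, if_false] at hwn
        have hc : (⌊f' n⌋ : ℝ) + 1 = c := by exact_mod_cast hwn
        rcases hcl with ⟨h1, _⟩ | ⟨h1, _⟩
        · exact absurd h1 hlt
        · constructor <;> linarith
    refine H.card_le_of_values hlam ((Finset.filter_subset _ _).trans (Finset.filter_subset _ _))
      (ℓ := 2 * Δ) (by linarith) fun n₁ hn₁ n₂ hn₂ => ?_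
    have h1 := hval n₁ hn₁
    have h2 := hval n₂ hn₂
    linarith
  have hcard := Finset.card_eq_sum_card_fiberwise hmaps
  have : (W.card : ℝ) = ∑ c ∈ t, (((W.filter fun n : ℤ => w n = c)).card : ℝ) := by
    rw [hcard]; push_cast; rfl
  rw [this]
  calc ∑ c ∈ t, (((W.filter fun n : ℤ => w n = c)).card : ℝ) ≤ ∑ c ∈ t, (2 * Δ / lam + 1) :=
        Finset.sum_le_sum hfib
    _ = ((Ck : ℝ) - C₀) * (2 * Δ / lam + 1) := by rw [Finset.sum_const, nsmul_eq_mul, hcardt]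

/-! ### The stretches `C_j + Δ ≤ f'(n) ≤ C_j + 1 - Δ`, `j = 1, …, k - 1` -/

/-- **The inner stretches.** On the integer points with `⌊f'(n)⌋ = ν`, `C₀ < ν < C_k`, and
`Δ ≤ {f'(n)} ≤ 1 - Δ`, Kusmin–Landau gives `2/(πΔ)` per `ν`, in total `(k - 1) · 2/(πΔ)`.
[cite: Yang2024, Lemma 2.1 (proof)] -/
theorem stretches_bound (H : SecondDerivHyp f f' a b lam h) (hlam : 0 < lam) {Δ : ℝ} (hΔ : 0 < Δ)
    (hk : ⌊f' a⌋ + 1 ≤ ⌊f' b⌋) :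
    ‖∑ n ∈ (Finset.Ioc a b).filter (fun n : ℤ => ⌊f' a⌋ < ⌊f' n⌋ ∧ ⌊f' n⌋ < ⌊f' b⌋ ∧
        Δ ≤ Int.fract (f' n) ∧ Int.fract (f' n) ≤ 1 - Δ), e (f n)‖
      ≤ ((⌊f' b⌋ : ℝ) - ⌊f' a⌋ - 1) * (2 / (π * Δ)) := by
  have hπ := Real.pi_pos
  set C₀ : ℤ := ⌊f' a⌋ with hC₀
  set Ck : ℤ := ⌊f' b⌋ with hCk
  set M := (Finset.Ioc a b).filter (fun n : ℤ => C₀ < ⌊f' n⌋ ∧ ⌊f' n⌋ < Ck ∧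
        Δ ≤ Int.fract (f' n) ∧ Int.fract (f' n) ≤ 1 - Δ) with hM
  have hmemM : ∀ n, n ∈ M ↔ n ∈ Finset.Ioc a b ∧ (C₀ < ⌊f' n⌋ ∧ ⌊f' n⌋ < Ck ∧
      Δ ≤ Int.fract (f' n) ∧ Int.fract (f' n) ≤ 1 - Δ) := fun n => by rw [hM, Finset.mem_filter]
  set t : Finset ℤ := Finset.Icc (C₀ + 1) (Ck - 1) with ht
  have hmaps : ∀ n ∈ M, ⌊f' n⌋ ∈ t := by
    intro n hn
    rw [hmemM] at hn
    rw [ht, Finset.mem_Icc]; omega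
  have hcardt : (t.card : ℝ) = (Ck : ℝ) - C₀ - 1 := by
    rw [ht, Int.card_Icc]
    have h0 : (0 : ℤ) ≤ Ck - 1 + 1 - (C₀ + 1) := by omega
    have : (((Ck - 1 + 1 - (C₀ + 1)).toNat : ℕ) : ℤ) = Ck - C₀ - 1 := by
      rw [Int.toNat_of_nonneg h0]; ring
    exact_mod_cast this
  rw [← Finset.sum_fiberwise_of_maps_to hmaps]
  have hfib : ∀ ν ∈ t, ‖∑ n ∈ M.filter (fun n : ℤ => ⌊f' n⌋ = ν), e (f n)‖ ≤ 2 / (π * Δ) := by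
    intro ν hν
    rw [ht, Finset.mem_Icc] at hν
    have hval : ∀ n ∈ M.filter (fun n : ℤ => ⌊f' n⌋ = ν), (ν : ℝ) + Δ ≤ f' n ∧ f' n ≤ ν + 1 - Δ := by
      intro n hn
      rw [Finset.mem_filter, hmemM] at hn
      have hff := Int.floor_add_fract (f' n)
      have hν' : (⌊f' n⌋ : ℝ) = ν := by exact_mod_cast hn.2
      constructor <;> linarith [hn.1.2.2.2.1, hn.1.2.2.2.2]
    have h := H.kl_vpiece hlam ((Finset.filter_subset _ _).trans (Finset.filter_subset _ _))
      (S := M.filter (fun n : ℤ => ⌊f' n⌋ = ν)) ?_ hΔ hΔ (ν := ν) hval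
    · have e2 : (1 / Δ + 1 / Δ) / π = 2 / (π * Δ) := by field_simp; ring
      rwa [e2] at h
    · intro n₁ hn₁ n₂ hn₂ n hn h1n hn2
      have h1 := hval n₁ hn₁
      have h2 := hval n₂ hn₂
      have hlo : (ν : ℝ) + Δ ≤ f' n := h1.1.trans h1n
      have hhi : f' n ≤ ν + 1 - Δ := hn2.trans h2.2
      have hfl : ⌊f' n⌋ = ν := by
        rw [Int.floor_eq_iff]; constructor <;> linarith
      have hfr : Int.fract (f' n) = f' n - ν := by
        rw [Int.fract, hfl]
      rw [Finset.mem_filter, hmemM]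
      refine ⟨⟨hn, by omega, by omega, ?_, ?_⟩, hfl⟩
      · rw [hfr]; linarith
      · rw [hfr]; linarith
  calc ‖∑ ν ∈ t, ∑ n ∈ M.filter (fun n : ℤ => ⌊f' n⌋ = ν), e (f n)‖
      ≤ ∑ ν ∈ t, ‖∑ n ∈ M.filter (fun n : ℤ => ⌊f' n⌋ = ν), e (f n)‖ := norm_sum_le _ _
    _ ≤ ∑ ν ∈ t, 2 / (π * Δ) := Finset.sum_le_sum hfib
    _ = ((Ck : ℝ) - C₀ - 1) * (2 / (π * Δ)) := by rw [Finset.sum_const, nsmul_eq_mul, hcardt]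


/-! ### The case `k = 0` (`⌊f'(a)⌋ = ⌊f'(b)⌋`) -/

/-- **No integer crossing.** If `⌊f'(b)⌋ = ⌊f'(a)⌋ = C₀`, all values `f'(n)` lie in
`[C₀ + ε₁, C₀ + ε₂]` and the three cases for each end combine to
`‖∑_{a<n≤b} e(f(n))‖ ≤ Φ(ε₁) + Φ(1 - ε₂) - 2/(πΔ)`. [cite: Yang2024, Lemma 2.1 (proof)] -/
theorem kzero_bound (H : SecondDerivHyp f f' a b lam h) (hlam : 0 < lam) (hab : a < b) {Δ : ℝ}
    (hΔ : 0 < Δ) (hΔ4 : Δ ≤ 1 / 4) (hlamΔ : lam = π * Δ ^ 2) (hk : ⌊f' b⌋ = ⌊f' a⌋) :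
    ‖∑ n ∈ Finset.Ioc a b, e (f n)‖
      ≤ (3 / (π * Δ) - (4 / (π * Δ) + 1) * (Int.fract (f' a) - 1 / 2)) + (3 / (π * Δ) - (4 / (π * Δ) + 1) * (1 - Int.fract (f' b) - 1 / 2)) - 2 / (π * Δ) := by
  have hπ := Real.pi_pos
  set C₀ : ℤ := ⌊f' a⌋ with hC₀
  set ε₁ : ℝ := Int.fract (f' a) with hε₁
  set ε₂ : ℝ := Int.fract (f' b) with hε₂
  have hfa : f' a = C₀ + ε₁ := by rw [hε₁, hC₀, Int.fract]; ring
  have hfb : f' b = C₀ + ε₂ := by rw [hε₂, Int.fract, hk]; ring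
  have hε₁0 : 0 ≤ ε₁ := Int.fract_nonneg _
  have hε₂1 : ε₂ < 1 := Int.fract_lt_one _
  have hab' : (a : ℝ) ≤ b := by exact_mod_cast hab.le
  have hε12 : ε₁ < ε₂ := by
    have h1 := (H.incr a ⟨le_rfl, hab'⟩ b ⟨hab', le_rfl⟩ hab').1
    have h2 : (1 : ℝ) ≤ (b : ℝ) - a := by
      have : a + 1 ≤ b := hab
      have : ((a : ℤ) : ℝ) + 1 ≤ b := by exact_mod_cast this
      linarith
    have h3 : lam * 1 ≤ lam * ((b : ℝ) - a) := mul_le_mul_of_nonneg_left h2 hlam.le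
    rw [hfa, hfb] at h1
    linarith
  have hval : ∀ n ∈ Finset.Ioc a b, (C₀ : ℝ) + ε₁ ≤ f' n ∧ f' n ≤ C₀ + ε₂ := fun n hn => by
    have := H.value_between hlam hn
    rw [hfa, hfb] at this
    exact this
  set T := Finset.Ioc a b with hT
  -- the three pieces
  set A := T.filter (fun n : ℤ => f' n < C₀ + Δ) with hA
  set R := T.filter (fun n : ℤ => ¬ f' n < C₀ + Δ) with hR
  set Md := R.filter (fun n : ℤ => f' n ≤ C₀ + 1 - Δ) with hMd
  set B := R.filter (fun n : ℤ => ¬ f' n ≤ C₀ + 1 - Δ) with hB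
  have hsplit : ∑ n ∈ T, e (f n) = ∑ n ∈ A, e (f n) + (∑ n ∈ Md, e (f n) + ∑ n ∈ B, e (f n)) := by
    rw [Finset.sum_filter_add_sum_filter_not, Finset.sum_filter_add_sum_filter_not]
  have hAT : A ⊆ T := Finset.filter_subset _ _
  have hRT : R ⊆ T := Finset.filter_subset _ _
  have hMdT : Md ⊆ T := (Finset.filter_subset _ _).trans hRT
  have hBT : B ⊆ T := (Finset.filter_subset _ _).trans hRT
  have hmemA : ∀ n, n ∈ A ↔ n ∈ T ∧ f' n < C₀ + Δ := fun n => by rw [hA, Finset.mem_filter]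
  have hmemMd : ∀ n, n ∈ Md ↔ n ∈ T ∧ (C₀ : ℝ) + Δ ≤ f' n ∧ f' n ≤ C₀ + 1 - Δ := fun n => by
    rw [hMd, Finset.mem_filter, hR, Finset.mem_filter, not_lt, and_assoc]
  have hmemB : ∀ n, n ∈ B ↔ n ∈ T ∧ (C₀ : ℝ) + 1 - Δ < f' n := fun n => by
    rw [hB, Finset.mem_filter, hR, Finset.mem_filter, not_lt, not_le, and_assoc]
    constructor
    · rintro ⟨h1, _, h3⟩; exact ⟨h1, h3⟩
    · rintro ⟨h1, h3⟩; exact ⟨h1, by linarith, h3⟩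
  -- A: nonempty only if ε₁ < Δ
  have hA1 : ε₁ < Δ → ‖∑ n ∈ A, e (f n)‖ ≤ (Δ - ε₁) / lam + 1 := by
    intro h1
    refine (norm_sum_e_le_card _ (fun n => f n)).trans ?_
    refine H.card_le_of_values hlam hAT (ℓ := Δ - ε₁) (by linarith) fun n₁ hn₁ n₂ hn₂ => ?_
    rw [hmemA] at hn₁ hn₂
    linarith [(hval n₁ hn₁.1).1, hn₂.2]
  have hA2 : Δ ≤ ε₁ → ∑ n ∈ A, e (f n) = 0 := by
    intro h2
    have : A = ∅ := by
      rw [Finset.eq_empty_iff_forall_notMem]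
      intro n hn
      rw [hmemA] at hn
      linarith [(hval n hn.1).1, hn.2]
    rw [this, sum_empty]
  -- B: nonempty only if ε₂ > 1 - Δ
  have hB1 : 1 - Δ < ε₂ → ‖∑ n ∈ B, e (f n)‖ ≤ (Δ - (1 - ε₂)) / lam + 1 := by
    intro h1
    refine (norm_sum_e_le_card _ (fun n => f n)).trans ?_
    refine H.card_le_of_values hlam hBT (ℓ := Δ - (1 - ε₂)) (by linarith) fun n₁ hn₁ n₂ hn₂ => ?_
    rw [hmemB] at hn₁ hn₂
    linarith [(hval n₂ hn₂.1).2, hn₁.2]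
  have hB2 : ε₂ ≤ 1 - Δ → ∑ n ∈ B, e (f n) = 0 := by
    intro h2
    have : B = ∅ := by
      rw [Finset.eq_empty_iff_forall_notMem]
      intro n hn
      rw [hmemB] at hn
      linarith [(hval n hn.1).2, hn.2]
    rw [this, sum_empty]
  -- Md: Kusmin–Landau with any admissible `(λ', μ')`
  have hMd1 : ∀ lam' mu' : ℝ, 0 < lam' → 0 < mu' → (lam' ≤ Δ ∨ lam' ≤ ε₁) →
      (mu' ≤ Δ ∨ mu' ≤ 1 - ε₂) → ‖∑ n ∈ Md, e (f n)‖ ≤ (1 / lam' + 1 / mu') / π := by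
    intro lam' mu' hl hm hl' hm'
    refine H.kl_vpiece hlam hMdT ?_ hl hm (ν := C₀) ?_
    · intro n₁ hn₁ n₂ hn₂ n hn h1n hn2
      rw [hmemMd] at hn₁ hn₂ ⊢
      exact ⟨hn, hn₁.2.1.trans h1n, hn2.trans hn₂.2.2⟩
    · intro n hn
      rw [hmemMd] at hn
      have hv := hval n hn.1
      constructor
      · rcases hl' with h | h <;> linarith [hn.2.1, hv.1]
      · rcases hm' with h | h <;> linarith [hn.2.2, hv.2]
  have hMd2 : (1 - Δ < ε₁ ∨ ε₂ < Δ) → ∑ n ∈ Md, e (f n) = 0 := by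
    intro hc
    have : Md = ∅ := by
      rw [Finset.eq_empty_iff_forall_notMem]
      intro n hn
      rw [hmemMd] at hn
      have hv := hval n hn.1
      rcases hc with hc | hc <;> linarith [hn.2.1, hn.2.2]
    rw [this, sum_empty]
  have e2Δ : (1 / Δ + 1 / Δ) / π = 2 / (π * Δ) := by field_simp; ring
  have eΔx : ∀ x : ℝ, 0 < x → (1 / Δ + 1 / x) / π = 2 / (π * Δ) + ((1 / x + 1 / Δ) / π - 2 / (π * Δ)) := by
    intro x _; ring
  rw [hsplit]
  have htri : ‖∑ n ∈ A, e (f n) + (∑ n ∈ Md, e (f n) + ∑ n ∈ B, e (f n))‖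
      ≤ ‖∑ n ∈ A, e (f n)‖ + (‖∑ n ∈ Md, e (f n)‖ + ‖∑ n ∈ B, e (f n)‖) :=
    (norm_add_le _ _).trans (add_le_add le_rfl (norm_add_le _ _))
  refine htri.trans ?_
  -- the six feasible cases
  rcases lt_or_ge ε₁ Δ with e1l | e1m
  · have jA := J_case1 hΔ hΔ4 hlamΔ hε₁0 e1l
    have hAb := hA1 e1l
    rcases lt_or_ge (1 - Δ) ε₂ with e2h | e2m
    · -- (1, 1')
      have jB := J_case1 hΔ hΔ4 hlamΔ (by linarith : (0 : ℝ) ≤ 1 - ε₂) (by linarith)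
      have hBb := hB1 e2h
      have hMb := hMd1 Δ Δ hΔ hΔ (Or.inl le_rfl) (Or.inl le_rfl)
      rw [e2Δ] at hMb
      linarith
    · rw [hB2 e2m, norm_zero, add_zero]
      rcases lt_or_ge ε₂ Δ with e2l | e2m'
      · -- (1, 3'): only `A`
        rw [hMd2 (Or.inr e2l), norm_zero, add_zero]
        have jB := J_case3 hΔ hΔ4 (by linarith : 1 - ε₂ ≤ 1)
        have : 0 ≤ 2 / (π * Δ) := by positivity
        nlinarith [jA, jB, hAb]
      · -- (1, 2')
        have jB := J_case2 hΔ hΔ4 (by linarith : Δ ≤ 1 - ε₂) (by linarith)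
        have hMb := hMd1 Δ (1 - ε₂) hΔ (by linarith) (Or.inl le_rfl) (Or.inr le_rfl)
        rw [eΔx (1 - ε₂) (by linarith)] at hMb
        linarith
  · rw [hA2 e1m, norm_zero, zero_add]
    rcases le_or_gt ε₁ (1 - Δ) with e1m' | e1h
    · have jA := J_case2 hΔ hΔ4 e1m e1m'
      have hε₁pos : 0 < ε₁ := lt_of_lt_of_le hΔ e1m
      rcases lt_or_ge (1 - Δ) ε₂ with e2h | e2m
      · -- (2, 1')
        have jB := J_case1 hΔ hΔ4 hlamΔ (by linarith : (0 : ℝ) ≤ 1 - ε₂) (by linarith)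
        have hBb := hB1 e2h
        have hMb := hMd1 ε₁ Δ hε₁pos hΔ (Or.inr le_rfl) (Or.inl le_rfl)
        linarith
      · -- (2, 2')
        rw [hB2 e2m, norm_zero, add_zero]
        have hΔε₂ : Δ ≤ 1 - ε₂ := by linarith
        have jB := J_case2 hΔ hΔ4 hΔε₂ (by linarith)
        have hMb := hMd1 ε₁ (1 - ε₂) hε₁pos (by linarith) (Or.inr le_rfl) (Or.inr le_rfl)
        have e3 : (1 / ε₁ + 1 / (1 - ε₂)) / π
            = (1 / ε₁ + 1 / Δ) / π + (1 / (1 - ε₂) + 1 / Δ) / π - 2 / (π * Δ) := by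
          field_simp; ring
        linarith
    · -- (3, 1'): only `B`
      have e2h : 1 - Δ < ε₂ := by linarith
      rw [hMd2 (Or.inl e1h), norm_zero, zero_add]
      have jA := J_case3 hΔ hΔ4 (Int.fract_lt_one (f' a)).le
      have jB := J_case1 hΔ hΔ4 hlamΔ (by linarith : (0 : ℝ) ≤ 1 - ε₂) (by linarith)
      have hBb := hB1 e2h
      have : 0 ≤ 2 / (π * Δ) := by positivity
      linarith

end SecondDerivHyp

/-! ### Classification of a value `u = f'(n)` (`k ≥ 1`) -/

section classify

variable {u Δ : ℝ} {C₀ Ck : ℤ}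

/-- A final-piece value is not an initial-piece value when `k ≥ 1`. [folklore] -/
theorem not_initial_of_final (hΔ : 0 < Δ) (hk : C₀ + 1 ≤ Ck) (hF : (Ck : ℝ) + Δ ≤ u) :
    ¬ u ≤ C₀ + 1 - Δ := by
  have : ((C₀ : ℤ) : ℝ) + 1 ≤ Ck := by exact_mod_cast hk
  intro hI; linarith

/-- A window value is neither initial nor final. [folklore] -/
theorem not_initial_final_of_window (hΔ : 0 < Δ) (hlo : C₀ ≤ ⌊u⌋) (hhi : ⌊u⌋ ≤ Ck)
    (hW : (Int.fract u < Δ ∧ C₀ < ⌊u⌋) ∨ (1 - Δ < Int.fract u ∧ ⌊u⌋ < Ck)) :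
    ¬ u ≤ C₀ + 1 - Δ ∧ ¬ (Ck : ℝ) + Δ ≤ u := by
  have hff := Int.floor_add_fract u
  have hf0 := Int.fract_nonneg u
  have hf1 := Int.fract_lt_one u
  rcases hW with ⟨h1, h2⟩ | ⟨h1, h2⟩
  · have h2' : ((C₀ : ℤ) : ℝ) + 1 ≤ ⌊u⌋ := by exact_mod_cast h2
    have hhi' : ((⌊u⌋ : ℤ) : ℝ) ≤ Ck := by exact_mod_cast hhi
    constructor <;> intro h <;> linarith
  · have h2' : ((⌊u⌋ : ℤ) : ℝ) + 1 ≤ Ck := by exact_mod_cast h2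
    have hlo' : ((C₀ : ℤ) : ℝ) ≤ ⌊u⌋ := by exact_mod_cast hlo
    constructor <;> intro h <;> linarith

/-- A stretch value is neither initial, final, nor window. [folklore] -/
theorem not_others_of_stretch (hΔ : 0 < Δ)
    (hM : C₀ < ⌊u⌋ ∧ ⌊u⌋ < Ck ∧ Δ ≤ Int.fract u ∧ Int.fract u ≤ 1 - Δ) :
    ¬ u ≤ C₀ + 1 - Δ ∧ ¬ (Ck : ℝ) + Δ ≤ u ∧
      ¬ ((Int.fract u < Δ ∧ C₀ < ⌊u⌋) ∨ (1 - Δ < Int.fract u ∧ ⌊u⌋ < Ck)) := by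
  have hff := Int.floor_add_fract u
  obtain ⟨h1, h2, h3, h4⟩ := hM
  have h1' : ((C₀ : ℤ) : ℝ) + 1 ≤ ⌊u⌋ := by exact_mod_cast h1
  have h2' : ((⌊u⌋ : ℤ) : ℝ) + 1 ≤ Ck := by exact_mod_cast h2
  refine ⟨fun h => by linarith, fun h => by linarith, ?_⟩
  rintro (⟨h5, _⟩ | ⟨h5, _⟩) <;> linarith

/-- The four kinds exhaust the values with `C₀ ≤ ⌊u⌋ ≤ C_k` (`k ≥ 1`). [folklore] -/
theorem stretch_of_not_others (hk : C₀ + 1 ≤ Ck) (hlo : C₀ ≤ ⌊u⌋) (hhi : ⌊u⌋ ≤ Ck)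
    (hnI : ¬ u ≤ C₀ + 1 - Δ) (hnF : ¬ (Ck : ℝ) + Δ ≤ u)
    (hnW : ¬ ((Int.fract u < Δ ∧ C₀ < ⌊u⌋) ∨ (1 - Δ < Int.fract u ∧ ⌊u⌋ < Ck))) :
    C₀ < ⌊u⌋ ∧ ⌊u⌋ < Ck ∧ Δ ≤ Int.fract u ∧ Int.fract u ≤ 1 - Δ := by
  have hff := Int.floor_add_fract u
  have hnI' : (C₀ : ℝ) + 1 - Δ < u := not_le.1 hnI
  have hnF' : u < (Ck : ℝ) + Δ := not_le.1 hnF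
  obtain ⟨hW1, hW2⟩ := not_or.1 hnW
  have hC₀ : C₀ < ⌊u⌋ := by
    by_contra hc
    have heq : ⌊u⌋ = C₀ := le_antisymm (not_lt.1 hc) hlo
    have heq' : ((⌊u⌋ : ℤ) : ℝ) = C₀ := by exact_mod_cast heq
    -- then `{u} > 1 - Δ` and `⌊u⌋ < Ck`: a window of the second kind
    have h1 : 1 - Δ < Int.fract u := by linarith
    have h2 : ⌊u⌋ < Ck := by omega
    exact hW2 ⟨h1, h2⟩
  have hCk : ⌊u⌋ < Ck := by
    by_contra hc
    have heq : ⌊u⌋ = Ck := le_antisymm hhi (not_lt.1 hc)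
    have heq' : ((⌊u⌋ : ℤ) : ℝ) = Ck := by exact_mod_cast heq
    have h1 : Int.fract u < Δ := by linarith
    exact hW1 ⟨h1, hC₀⟩
  refine ⟨hC₀, hCk, ?_, ?_⟩
  · by_contra h; exact hW1 ⟨not_le.1 h, hC₀⟩
  · by_contra h; exact hW2 ⟨not_le.1 h, hCk⟩

end classify

/-! ### Yang's Lemma 2.1 -/

/-- **Yang's explicit second-derivative test, core form** (`f'` increasing, increment hypotheses
`λ(y₂ - y₁) ≤ f'(y₂) - f'(y₁) ≤ hλ(y₂ - y₁)` on `[a, b]`, `a ≤ b` integers, `λ > 0`, `h ≥ 1`):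
`‖∑_{a<n≤b} e(f(n))‖ ≤ (4/√π)(b - a)h λ^{1/2} + (b - a)hλ + (4/√π)λ^{-1/2}`.
[cite: Yang2024, Lemma 2.1] -/
theorem secondDerivTest_yang_core {f f' : ℝ → ℝ} {a b : ℤ} {lam h : ℝ} (hab : a ≤ b)
    (hlam : 0 < lam) (hh : 1 ≤ h) (H : SecondDerivHyp f f' a b lam h) :
    ‖∑ n ∈ Finset.Ioc a b, e (f n)‖
      ≤ 4 / Real.sqrt π * ((b : ℝ) - a) * h * Real.sqrt lam + ((b : ℝ) - a) * h * lam
        + 4 / Real.sqrt π * (1 / Real.sqrt lam) := by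
  have hπ := Real.pi_pos
  have hsπ : 0 < Real.sqrt π := Real.sqrt_pos.2 hπ
  have hsl : 0 < Real.sqrt lam := Real.sqrt_pos.2 hlam
  have hab' : (a : ℝ) ≤ b := by exact_mod_cast hab
  set N : ℝ := (b : ℝ) - a with hN
  have hN0 : 0 ≤ N := by rw [hN]; linarith
  -- trivial bound
  have htriv : ‖∑ n ∈ Finset.Ioc a b, e (f n)‖ ≤ N := by
    refine (norm_sum_e_le_card _ (fun n => f n)).trans ?_
    rw [Int.card_Ioc, hN]
    have h1 : (((b - a).toNat : ℕ) : ℤ) = b - a := Int.toNat_of_nonneg (by linarith)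
    have h2 : (((b - a).toNat : ℕ) : ℝ) = ((b - a : ℤ) : ℝ) := by exact_mod_cast h1
    rw [h2]; push_cast; exact le_rfl
  have hpos2 : 0 ≤ N * h * lam := by positivity
  have hpos3 : 0 ≤ 4 / Real.sqrt π * (1 / Real.sqrt lam) := by positivity
  -- Case `λ > π/16`: the trivial bound suffices since `(4/√π)λ^{1/2} ≥ 1`.
  rcases lt_or_ge (π / 16) lam with hbig | hsmall
  · have h1 : 1 ≤ 4 / Real.sqrt π * Real.sqrt lam := by
      rw [div_mul_eq_mul_div, le_div_iff₀ hsπ, one_mul]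
      have : Real.sqrt π = 4 * Real.sqrt (π / 16) := by
        rw [show π / 16 = π / 4 ^ 2 by norm_num, Real.sqrt_div' _ (by norm_num : (0:ℝ) ≤ 4 ^ 2),
          Real.sqrt_sq (by norm_num : (0:ℝ) ≤ 4)]
        field_simp
      rw [this]
      exact mul_le_mul_of_nonneg_left (Real.sqrt_le_sqrt hbig.le) (by norm_num)
    have h2 : N ≤ 4 / Real.sqrt π * N * h * Real.sqrt lam := by
      have : N * 1 ≤ N * (4 / Real.sqrt π * Real.sqrt lam) * h := by
        have h3 : N * 1 ≤ N * (4 / Real.sqrt π * Real.sqrt lam) :=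
          mul_le_mul_of_nonneg_left h1 hN0
        have h4 : N * (4 / Real.sqrt π * Real.sqrt lam) * 1 ≤ N * (4 / Real.sqrt π * Real.sqrt lam) * h :=
          mul_le_mul_of_nonneg_left hh (by positivity)
        linarith
      linarith
    linarith
  -- Main case `λ ≤ π/16`: `Δ = (λ/π)^{1/2} ≤ 1/4`.
  set Δ : ℝ := Real.sqrt (lam / π) with hΔdef
  have hΔ : 0 < Δ := Real.sqrt_pos.2 (by positivity)
  have hΔsq : Δ ^ 2 = lam / π := Real.sq_sqrt (by positivity)
  have hlamΔ : lam = π * Δ ^ 2 := by rw [hΔsq]; field_simp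
  have hΔ4 : Δ ≤ 1 / 4 := by
    rw [hΔdef, show (1 / 4 : ℝ) = Real.sqrt ((1 / 4) ^ 2) by rw [Real.sqrt_sq (by norm_num)]]
    exact Real.sqrt_le_sqrt (by rw [div_le_iff₀ hπ]; nlinarith)
  have hpΔ : 0 < π * Δ := by positivity
  -- the identities `λ/(πΔ) = Δ`, `Δ/λ = 1/(πΔ)`, `(4/√π)√λ = 4Δ`, `(4/√π)/√λ = 4/(πΔ)`
  have hΔsl : Δ = Real.sqrt lam / Real.sqrt π := by
    rw [hΔdef, Real.sqrt_div' _ hπ.le]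
  have e_main : 4 / Real.sqrt π * N * h * Real.sqrt lam = 4 * N * h * Δ := by
    rw [hΔsl]; field_simp
  have e_tail : 4 / Real.sqrt π * (1 / Real.sqrt lam) = 4 / (π * Δ) := by
    have : π * Δ = Real.sqrt π * Real.sqrt lam := by
      rw [hΔsl]
      have := Real.mul_self_sqrt hπ.le
      field_simp
      nlinarith [this]
    rw [this]; field_simp
  have e_lamΔ : lam / (π * Δ) = Δ := by rw [hlamΔ]; field_simp
  have e_Δlam : 2 * Δ / lam = 2 / (π * Δ) := by rw [hlamΔ]; field_simp
  rw [e_main, e_tail]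
  -- notation
  set C₀ : ℤ := ⌊f' a⌋ with hC₀
  set Ck : ℤ := ⌊f' b⌋ with hCk
  set ε₁ : ℝ := Int.fract (f' a) with hε₁
  set ε₂ : ℝ := Int.fract (f' b) with hε₂
  have hfa : f' a = C₀ + ε₁ := by rw [hε₁, hC₀, Int.fract]; ring
  have hfb : f' b = Ck + ε₂ := by rw [hε₂, hCk, Int.fract]; ring
  have hCC : C₀ ≤ Ck := Int.floor_mono (H.mono hlam ⟨le_rfl, hab'⟩ ⟨hab', le_rfl⟩ hab')
  -- `k ≤ Nhλ + ε₁ - ε₂`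
  have hk_le : (Ck : ℝ) - C₀ ≤ N * h * lam + ε₁ - ε₂ := by
    have h1 := (H.incr a ⟨le_rfl, hab'⟩ b ⟨hab', le_rfl⟩ hab').2
    rw [hfa, hfb] at h1
    have : h * lam * ((b : ℝ) - a) = N * h * lam := by rw [hN]; ring
    linarith
  -- the unified intermediate bound
  have hmid : ‖∑ n ∈ Finset.Ioc a b, e (f n)‖
      ≤ (3 / (π * Δ) - (4 / (π * Δ) + 1) * (ε₁ - 1 / 2)) + (3 / (π * Δ) - (4 / (π * Δ) + 1) * (1 - ε₂ - 1 / 2)) + ((Ck : ℝ) - C₀) * (2 * Δ / lam + 1)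
        + ((Ck : ℝ) - C₀ - 1) * (2 / (π * Δ)) := by
    rcases eq_or_lt_of_le hCC with hk0 | hk1
    · -- k = 0
      rcases eq_or_lt_of_le hab with hab0 | hab1
      · -- empty sum
        subst hab0
        rw [Finset.Ioc_self, sum_empty, norm_zero, ← hk0]
        have hfract : ε₁ = ε₂ := by rw [hε₁, hε₂]
        rw [hfract]
        ring_nf
        positivity
      · have h0 := H.kzero_bound hlam hab1 hΔ hΔ4 hlamΔ hk0.symm
        rw [← hk0]
        have : ((C₀ : ℝ) - C₀) * (2 * Δ / lam + 1) + ((C₀ : ℝ) - C₀ - 1) * (2 / (π * Δ))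
            = -(2 / (π * Δ)) := by ring
        linarith
    · -- k ≥ 1 : partition into the four kinds
      have hk : C₀ + 1 ≤ Ck := hk1
      set T := Finset.Ioc a b with hT
      have hfl : ∀ n ∈ T, C₀ ≤ ⌊f' n⌋ ∧ ⌊f' n⌋ ≤ Ck := fun n hn => by
        have := H.value_between hlam hn
        exact ⟨Int.floor_mono this.1, Int.floor_mono this.2⟩
      set pI : ℤ → Prop := fun n => f' n ≤ C₀ + 1 - Δ with hpI
      set pF : ℤ → Prop := fun n => (Ck : ℝ) + Δ ≤ f' n with hpF
      set pW : ℤ → Prop := fun n =>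
        (Int.fract (f' n) < Δ ∧ C₀ < ⌊f' n⌋) ∨ (1 - Δ < Int.fract (f' n) ∧ ⌊f' n⌋ < Ck) with hpW
      set pM : ℤ → Prop := fun n =>
        C₀ < ⌊f' n⌋ ∧ ⌊f' n⌋ < Ck ∧ Δ ≤ Int.fract (f' n) ∧ Int.fract (f' n) ≤ 1 - Δ with hpM
      have hsplit : ∑ n ∈ T, e (f n) = ∑ n ∈ T.filter pI, e (f n) + (∑ n ∈ T.filter pF, e (f n)
          + (∑ n ∈ T.filter pW, e (f n) + ∑ n ∈ T.filter pM, e (f n))) := by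
        rw [← Finset.sum_filter_add_sum_filter_not T pI]
        congr 1
        rw [← Finset.sum_filter_add_sum_filter_not (T.filter fun n => ¬ pI n) pF]
        have e1 : (T.filter fun n => ¬ pI n).filter pF = T.filter pF := by
          ext n
          simp only [Finset.mem_filter, and_assoc]
          constructor
          · rintro ⟨h1, _, h3⟩; exact ⟨h1, h3⟩
          · rintro ⟨h1, h3⟩; exact ⟨h1, not_initial_of_final hΔ hk h3, h3⟩
        rw [e1]
        congr 1
        rw [← Finset.sum_filter_add_sum_filter_not ((T.filter fun n => ¬ pI n).filter fun n => ¬ pF n) pW]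
        have e2 : ((T.filter fun n => ¬ pI n).filter fun n => ¬ pF n).filter pW = T.filter pW := by
          ext n
          simp only [Finset.mem_filter, and_assoc]
          constructor
          · rintro ⟨h1, _, _, h4⟩; exact ⟨h1, h4⟩
          · rintro ⟨h1, h4⟩
            have := not_initial_final_of_window hΔ (hfl n h1).1 (hfl n h1).2 h4
            exact ⟨h1, this.1, this.2, h4⟩
        have e3 : (((T.filter fun n => ¬ pI n).filter fun n => ¬ pF n).filter fun n => ¬ pW n)
            = T.filter pM := by
          ext n
          simp only [Finset.mem_filter, and_assoc]
          constructor
          · rintro ⟨h1, h2, h3, h4⟩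
            exact ⟨h1, stretch_of_not_others hk (hfl n h1).1 (hfl n h1).2 h2 h3 h4⟩
          · rintro ⟨h1, h4⟩
            have := not_others_of_stretch (Ck := Ck) hΔ h4
            exact ⟨h1, this.1, this.2.1, this.2.2⟩
        rw [e2, e3]
      have bI := H.initial_piece hlam hΔ hΔ4 hlamΔ
      have bF := H.final_piece hlam hΔ hΔ4 hlamΔ
      have bW := (norm_sum_e_le_card (T.filter pW) (fun n => f n)).trans (H.windows_card hlam hab hΔ hΔ4)
      have bM := H.stretches_bound hlam hΔ hk
      rw [hsplit]
      calc _ ≤ ‖∑ n ∈ T.filter pI, e (f n)‖ + (‖∑ n ∈ T.filter pF, e (f n)‖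
            + (‖∑ n ∈ T.filter pW, e (f n)‖ + ‖∑ n ∈ T.filter pM, e (f n)‖)) :=
            (norm_add_le _ _).trans (add_le_add le_rfl ((norm_add_le _ _).trans
              (add_le_add le_rfl (norm_add_le _ _))))
        _ ≤ (3 / (π * Δ) - (4 / (π * Δ) + 1) * (ε₁ - 1 / 2)) + ((3 / (π * Δ) - (4 / (π * Δ) + 1) * (1 - ε₂ - 1 / 2)) + (((Ck : ℝ) - C₀) * (2 * Δ / lam + 1)
            + ((Ck : ℝ) - C₀ - 1) * (2 / (π * Δ)))) := by
            gcongr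
        _ = _ := by ring
  -- the final algebra
  refine hmid.trans ?_
  rw [e_Δlam]
  have hP : 0 ≤ 1 / (π * Δ) := by positivity
  have e1 : 2 / (π * Δ) = 2 * (1 / (π * Δ)) := by ring
  have e3 : 3 / (π * Δ) = 3 * (1 / (π * Δ)) := by ring
  have e4 : 4 / (π * Δ) = 4 * (1 / (π * Δ)) := by ring
  rw [e1, e3, e4]
  have key : ((Ck : ℝ) - C₀) * (4 * (1 / (π * Δ)) + 1)
      ≤ (N * h * lam + ε₁ - ε₂) * (4 * (1 / (π * Δ)) + 1) :=
    mul_le_mul_of_nonneg_right hk_le (by positivity)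
  have e5 : N * h * lam * (1 / (π * Δ)) = N * h * Δ := by
    calc N * h * lam * (1 / (π * Δ)) = N * h * (lam / (π * Δ)) := by ring
      _ = N * h * Δ := by rw [e_lamΔ]
  nlinarith [key, e5, hP]

/-- **Yang's explicit second-derivative test** (Yang 2024, Lemma 2.1): let `a ≤ b` be integers,
`f, f'` differentiable on `[a, b]` with `λ ≤ f''(y) ≤ hλ` for all `y ∈ [a, b]`, or
`λ ≤ -f''(y) ≤ hλ` for all `y ∈ [a, b]` (`λ > 0`, `h ≥ 1`). Then
`‖∑_{a<n≤b} e(f(n))‖ ≤ (4/√π)(b - a) h λ^{1/2} + (b - a) h λ + (4/√π) λ^{-1/2}`.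
[cite: Yang2024, Lemma 2.1] -/
theorem secondDerivTest_yang {f f' f'' : ℝ → ℝ} {a b : ℤ} {lam h : ℝ} (hab : a ≤ b)
    (hlam : 0 < lam) (hh : 1 ≤ h)
    (hf : ∀ y ∈ Set.Icc (a : ℝ) b, HasDerivAt f (f' y) y)
    (hf' : ∀ y ∈ Set.Icc (a : ℝ) b, HasDerivAt f' (f'' y) y)
    (hbound : (∀ y ∈ Set.Icc (a : ℝ) b, lam ≤ f'' y ∧ f'' y ≤ h * lam) ∨
      (∀ y ∈ Set.Icc (a : ℝ) b, lam ≤ -f'' y ∧ -f'' y ≤ h * lam)) :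
    ‖∑ n ∈ Finset.Ioc a b, e (f n)‖
      ≤ 4 / Real.sqrt π * ((b : ℝ) - a) * h * Real.sqrt lam + ((b : ℝ) - a) * h * lam
        + 4 / Real.sqrt π * (1 / Real.sqrt lam) := by
  -- increments of a function with derivative between `λ` and `hλ`
  have incr_of : ∀ {g g' : ℝ → ℝ}, (∀ y ∈ Set.Icc (a : ℝ) b, HasDerivAt g (g' y) y) →
      (∀ y ∈ Set.Icc (a : ℝ) b, lam ≤ g' y ∧ g' y ≤ h * lam) →
      ∀ y₁ ∈ Set.Icc (a : ℝ) b, ∀ y₂ ∈ Set.Icc (a : ℝ) b, y₁ ≤ y₂ →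
        lam * (y₂ - y₁) ≤ g y₂ - g y₁ ∧ g y₂ - g y₁ ≤ h * lam * (y₂ - y₁) := by
    intro g g' hg hb y₁ h1 y₂ h2 h12
    rcases eq_or_lt_of_le h12 with heq | hlt
    · subst heq; simp
    have hsub : Set.Icc y₁ y₂ ⊆ Set.Icc (a : ℝ) b := Set.Icc_subset_Icc h1.1 h2.2
    obtain ⟨ξ, hξ, hξ'⟩ := exists_hasDerivAt_eq_slope g g' hlt
      (fun y hy => (hg y (hsub hy)).continuousAt.continuousWithinAt)
      (fun y hy => hg y (hsub (Set.Ioo_subset_Icc_self hy)))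
    have hξI : ξ ∈ Set.Icc (a : ℝ) b := hsub (Set.Ioo_subset_Icc_self hξ)
    have hpos : 0 < y₂ - y₁ := by linarith
    have heq : g y₂ - g y₁ = g' ξ * (y₂ - y₁) := by rw [hξ']; field_simp
    rw [heq]
    obtain ⟨hl, hu⟩ := hb ξ hξI
    exact ⟨by nlinarith, by nlinarith⟩
  rcases hbound with hpos | hneg
  · exact secondDerivTest_yang_core hab hlam hh ⟨hf, incr_of hf' hpos⟩
  · -- replace `f` by `-f`
    rw [← norm_sum_e_neg]
    have hf_neg : ∀ y ∈ Set.Icc (a : ℝ) b, HasDerivAt (fun y => -f y) (-f' y) y :=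
      fun y hy => (hf y hy).neg
    have hf'_neg : ∀ y ∈ Set.Icc (a : ℝ) b, HasDerivAt (fun y => -f' y) (-f'' y) y :=
      fun y hy => (hf' y hy).neg
    exact secondDerivTest_yang_core (f := fun y => -f y) (f' := fun y => -f' y) hab hlam hh
      ⟨hf_neg, incr_of hf'_neg hneg⟩

end VdC
end Literature.NumberTheory.LFunctions
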